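import Literature.NumberTheory.Automorphic.ModularLambdaCovering
import HarnessLib

/-!
# The three cusp neighbourhoods `B_∞, B_0, B_1` cover `X(2)` (Javanpeykar 2014, §3.2 / Thm. 3.4.5)

Topic `NumberTheory/Automorphic`; companion of `GammaTwoCuspCharts.lean` (the chart `z_∞` of
`X(2)` at `∞` is injective on the strip `Ṡ_∞ = {-1 ≤ Re τ < 1, Im τ > 1/2}`) and of
`GammaTwoGenerators.lean`, `ModularLambdaCovering.lean` (`SL₂(ℤ/2)` has six elements,
`ModularLambda.sl2_zmod_two_cases`). In A. Javanpeykar, *Polynomial bounds for Arakelov invariants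
of Belyi curves*, Algebra & Number Theory **8** (2014), arXiv:1403.6404, §3.2, the atlas of
`X(2) = Γ(2)∖ℍ ∪ {cusps}` consists of `B_κ = Γ(2) γ_κ' (Ṡ_∞) ∪ {κ}` for the three cusps
`κ = ∞, 0, 1` ("Since the open subsets `B_κ` cover `X(2)`, we have constructed an atlas"), and the
proof of Thm. 3.4.5 uses the sharper "since `s₁ < √3/2`, we have `X(2) = ∪_κ B_κ^{s₁}`", i.e.
already the parts of the `B_κ` of height `Im > 1/2 - log(s₁)/π` (`< √3/2`) cover. With the representatives
`γ_∞' = 1`, `γ_0' = S`, `γ_1' = T S T⁻¹ = (1 -2; 1 -1)` (which move `∞` to `∞, 0, 1` and are, up to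
sign, the involutions exchanging `κ` and `∞` — a valid choice of the paper's `γ_κ`), we prove:

* `exists_mem_Gamma_two_mul_eq` — **`SL₂(ℤ) = ⋃_κ Γ(2) γ_κ' T^ℤ`**: every `δ ∈ SL₂(ℤ)` is
  `ε γ_κ' T^m` with `ε ∈ Γ(2)` (the three double cosets `Γ(2)∖SL₂(ℤ)/Γ_∞`, i.e. the three cusps of
  `Γ(2)`; by reduction modulo `2`);
* `exists_re_T_zpow_smul_mem_Ico` — `Re (T^{2k} σ) ∈ [-1, 1)` for a suitable `k` (`T² ∈ Γ(2)`);
* **`exists_eq_smul_strip`** — every `τ ∈ ℍ` is `ε • γ_κ' • σ` with `ε ∈ Γ(2)`, `κ ∈ {∞, 0, 1}` and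
  `σ ∈ Ṡ_∞` with moreover `Im σ ≥ √3/2`: the `B_κ`, and already their parts of height `≥ √3/2`,
  cover `X(2)` (Mathlib's `ModularGroup.exists_smul_mem_fd` supplies a translate in the standard
  fundamental domain, where `Im ≥ √3/2`; normality of `Γ(2)` moves the even power of `T` across
  `γ_κ'`).

Theorems only; no definition, no named fact. Not here: the Riemann surface `X(2)` itself.

## References

* A. Javanpeykar, *Polynomial bounds for Arakelov invariants of Belyi curves* (appendix by
  P. Bruin), Algebra & Number Theory 8 (2014), no. 1, 89–140, doi:10.2140/ant.2014.8.89,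
  arXiv:1403.6404: §3.2, Def. 3.4.4, Thm. 3.4.5 (proof). [Javanpeykar2014]
* F. Diamond, J. Shurman, *A First Course in Modular Forms*, GTM 228 (2005), §2.4 and §3.8 (cusps
  of `Γ(2)`); standard.
-/

noncomputable section

namespace Literature.NumberTheory.Automorphic

open scoped MatrixGroups ModularGroup Modular
open CongruenceSubgroup Matrix.SpecialLinearGroup ModularGroup
open UpperHalfPlane hiding I

namespace GammaTwo

/-! ### `SL₂(ℤ) = ⋃_κ Γ(2) γ_κ T^ℤ` with `γ_∞ = 1`, `γ_0 = S`, `γ_1 = T S T⁻¹` -/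

/-- Reduction modulo `2` detects membership of `δ ρ⁻¹` in `Γ(2)`. [folklore] -/
theorem mul_inv_mem_Gamma_two_of_map_eq {δ ρ : SL(2, ℤ)}
    (h : map (Int.castRingHom (ZMod 2)) δ = map (Int.castRingHom (ZMod 2)) ρ) :
    δ * ρ⁻¹ ∈ Gamma 2 := by
  rw [Gamma_mem', map_mul, map_inv, h, mul_inv_cancel]

/-- `T² ∈ Γ(2)`, as an integer power: `T^{2k} ∈ Γ(2)`. [folklore] -/
theorem T_zpow_two_mul_mem_Gamma_two (k : ℤ) : T ^ (2 * k) ∈ Gamma 2 := by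
  simpa using ModularGroup_T_pow_mem_Gamma 2 (2 * k) (dvd_mul_right 2 k)

/-- **The double cosets `Γ(2)∖SL₂(ℤ)/Γ_∞`: three cusps.** Every `δ ∈ SL₂(ℤ)` is `ε γ T^m` with
`ε ∈ Γ(2)`, `m ∈ ℤ` and `γ ∈ {1, S, T S T⁻¹}` (`γ ∞ = ∞, 0, 1`: the three cusps of `Γ(2)`). Signs
are absorbed in `ε` (`-1 ∈ Γ(2)`). [cite: Javanpeykar2014, §3.2] -/
theorem exists_mem_Gamma_two_mul_eq (δ : SL(2, ℤ)) :
    ∃ ε ∈ Gamma 2, ∃ m : ℤ,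
      δ = ε * T ^ m ∨ δ = ε * (S * T ^ m) ∨ δ = ε * (T * S * T⁻¹ * T ^ m) := by
  rcases ModularLambda.sl2_zmod_two_cases (map (Int.castRingHom (ZMod 2)) δ) with
    h | h | h | h | h | h
  · refine ⟨δ, Gamma_mem'.mpr h, 0, Or.inl ?_⟩
    simp
  · refine ⟨δ * S⁻¹, mul_inv_mem_Gamma_two_of_map_eq h, 0, Or.inr (Or.inl ?_)⟩
    simp
  · refine ⟨δ * T⁻¹, mul_inv_mem_Gamma_two_of_map_eq h, 1, Or.inl ?_⟩
    simp
  · -- `δ ≡ T S ≡ (T S T⁻¹) T`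
    have h' : map (Int.castRingHom (ZMod 2)) δ =
        map (Int.castRingHom (ZMod 2)) (T * S * T⁻¹ * T ^ (1 : ℤ)) := by
      rw [h, zpow_one, inv_mul_cancel_right]
    refine ⟨δ * (T * S * T⁻¹ * T ^ (1 : ℤ))⁻¹, mul_inv_mem_Gamma_two_of_map_eq h', 1,
      Or.inr (Or.inr ?_)⟩
    rw [inv_mul_cancel_right]
  · -- `δ ≡ S T`
    have h' : map (Int.castRingHom (ZMod 2)) δ =
        map (Int.castRingHom (ZMod 2)) (S * T ^ (1 : ℤ)) := by
      rw [h, zpow_one]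
    exact ⟨δ * (S * T ^ (1 : ℤ))⁻¹, mul_inv_mem_Gamma_two_of_map_eq h', 1,
      Or.inr (Or.inl (by rw [inv_mul_cancel_right]))⟩
  · -- `δ ≡ S T S ≡ T S T⁻¹ · T^0` modulo `2` (`T⁻¹ ≡ T`, and `STS ≡ TST`: both are `(1 0; 1 1)`)
    have hmod : map (Int.castRingHom (ZMod 2)) (S * T * S) =
        map (Int.castRingHom (ZMod 2)) (T * S * T⁻¹ * T ^ (0 : ℤ)) := by
      rw [zpow_zero, mul_one]
      ext i j
      fin_cases i <;> fin_cases j <;>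
        simp [ModularGroup.coe_S, ModularGroup.coe_T, Matrix.mul_apply, Fin.sum_univ_two] <;>
          decide
    have h' : map (Int.castRingHom (ZMod 2)) δ =
        map (Int.castRingHom (ZMod 2)) (T * S * T⁻¹ * T ^ (0 : ℤ)) := h.trans hmod
    exact ⟨δ * (T * S * T⁻¹ * T ^ (0 : ℤ))⁻¹, mul_inv_mem_Gamma_two_of_map_eq h', 0,
      Or.inr (Or.inr (by rw [inv_mul_cancel_right]))⟩

/-! ### Normalising the real part by `T^{2k} ∈ Γ(2)` -/

/-- Every `σ ∈ ℍ` has a translate `T^{2k} σ = σ + 2k` with real part in `[-1, 1)`. [folklore] -/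
theorem exists_re_T_zpow_smul_mem_Ico (σ : ℍ) :
    ∃ k : ℤ, (T ^ (2 * k) • σ).re ∈ Set.Ico (-1 : ℝ) 1 := by
  refine ⟨-⌊(σ.re + 1) / 2⌋, ?_⟩
  rw [re_T_zpow_smul]
  have h1 := Int.floor_le ((σ.re + 1) / 2)
  have h2 := Int.lt_floor_add_one ((σ.re + 1) / 2)
  push_cast
  constructor <;> linarith

/-! ### The three cusp neighbourhoods cover `X(2)` -/

/-- **Javanpeykar 2014, §3.2 / proof of Thm. 3.4.5: the cusp neighbourhoods `B_∞, B_0, B_1` cover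
`X(2)`; indeed already the parts of height `≥ √3/2` do** ("Since the open subsets `B_κ` cover
`X(2)` …"; "since `s₁ < √3/2`, we have `X(2) = ∪_κ B_κ^{s₁}`"). Every `τ ∈ ℍ` is `ε γ σ` with
`ε ∈ Γ(2)`, `γ ∈ {1, S, T S T⁻¹}` (`γ_κ` for the cusps `κ = ∞, 0, 1`) and `σ` in the strip
`Ṡ_∞ = {-1 ≤ Re < 1, Im > 1/2}`, even with `Im σ ≥ √3/2` (the height of the corners of the
standard fundamental domain of `SL₂(ℤ)`, Mathlib's `exists_smul_mem_fd`).
[cite: Javanpeykar2014, §3.2 and Thm. 3.4.5 (proof)] -/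
theorem exists_eq_smul_strip (τ : ℍ) :
    ∃ γ : SL(2, ℤ), (γ = 1 ∨ γ = S ∨ γ = T * S * T⁻¹) ∧ ∃ ε ∈ Gamma 2, ∃ σ : ℍ,
      Real.sqrt 3 / 2 ≤ σ.im ∧ σ.re ∈ Set.Ico (-1 : ℝ) 1 ∧ τ = ε • γ • σ := by
  -- a translate in the standard fundamental domain
  obtain ⟨g, hg⟩ := exists_smul_mem_fd τ
  generalize hgt : g • τ = τ' at hg
  have him : Real.sqrt 3 / 2 ≤ τ'.im := by
    have h3 := three_le_four_mul_im_sq_of_mem_fd hg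
    have h0 := τ'.im_pos
    rw [div_le_iff₀ two_pos, Real.sqrt_le_left (by positivity)]
    nlinarith
  have hτ : τ = g⁻¹ • τ' := by rw [← hgt, inv_smul_smul]
  -- decompose `g⁻¹ = ε γ T^m`
  obtain ⟨ε, hε, m, hcases⟩ := exists_mem_Gamma_two_mul_eq g⁻¹
  -- normalise the real part of `T^m τ'` by an even power of `T`
  obtain ⟨k, hk⟩ := exists_re_T_zpow_smul_mem_Ico (T ^ m • τ')
  set σ : ℍ := T ^ (2 * k) • T ^ m • τ' with hσ
  have hσim : σ.im = τ'.im := by rw [hσ, im_T_zpow_smul, im_T_zpow_smul]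
  have hTm : T ^ m • τ' = T ^ (2 * -k) • σ := by
    rw [hσ, smul_smul, ← zpow_add, show 2 * -k + 2 * k = 0 by ring, zpow_zero, one_smul]
  -- `γ T^{-2k} = (γ T^{-2k} γ⁻¹) γ` with the conjugate in `Γ(2)`
  have key : ∀ γ : SL(2, ℤ), (ε * (γ * T ^ m)) • τ' =
      (ε * (γ * T ^ (2 * -k) * γ⁻¹)) • γ • σ := by
    intro γ
    rw [mul_smul, mul_smul, hTm, mul_smul, mul_smul, mul_smul, smul_smul γ⁻¹ γ, inv_mul_cancel,
      one_smul]
  have hmem : ∀ γ : SL(2, ℤ), ε * (γ * T ^ (2 * -k) * γ⁻¹) ∈ Gamma 2 := fun γ ↦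
    Subgroup.mul_mem _ hε ((Gamma_normal 2).conj_mem _ (T_zpow_two_mul_mem_Gamma_two (-k)) γ)
  have finish : ∀ γ : SL(2, ℤ), g⁻¹ = ε * (γ * T ^ m) → ∃ ε' ∈ Gamma 2, ∃ σ' : ℍ,
      Real.sqrt 3 / 2 ≤ σ'.im ∧ σ'.re ∈ Set.Ico (-1 : ℝ) 1 ∧ τ = ε' • γ • σ' := by
    intro γ h
    exact ⟨_, hmem γ, σ, hσim ▸ him, hk, by rw [hτ, h, key γ]⟩
  rcases hcases with h | h | h
  · exact ⟨1, Or.inl rfl, finish 1 (by rw [one_mul]; exact h)⟩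
  · exact ⟨S, Or.inr (Or.inl rfl), finish S h⟩
  · exact ⟨T * S * T⁻¹, Or.inr (Or.inr rfl), finish _ h⟩

end GammaTwo

end Literature.NumberTheory.Automorphic

end
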